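import Summits.ResolutionOfSingularities.ResolutionOfSingularities.Theorems.FrobeniusClosingSteerInitialFormOfCongruence
import HarnessLib

/-!
# Crux `Steer` (stmt-ResolutionOfSingularities-16345), chain W4.1 — K-β0(b) gr bridge, brick (G3a):
# congruence algebra for initial forms — unit multiples, parameter multiples, UNIT-OR-ZERO coefficient forms, lowest form

OURS (campaign `res-hironaka`, rung L ★L-G4, slot W4.1; seat res-L0-w41-stub-4 g7 on res-L0-w41-plan-1 RULINGS 268(a)/282(f) «(G3) point-step cone
transport in gr currency»). Replaces the role of no printed item; NOT a statement of the manuscript under review [claim: Hironaka2017, status: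
under-review]; AI-produced, weaker than expert review. Theses-free, definition-free, words-free. Currency: tree `Literature.RingTheory.HilbertSamuel`
(`mOrder`, `inForm`) through (G1) `…InitialFormOfCongruence`.

Along a point step the coefficients coming from the previous member ring are UNITS OR MULTIPLES OF THE EXCEPTIONAL PARAMETER; modulo that
parameter they are units or ZERO. This file is the bookkeeping for such data:
* `sub_eval_C_mul_mem` / `sub_eval_X_pow_mul_mem` — congruences `f ≡ F(x)` survive multiplication by a unit / by a power of a parameter
  (degree shifts by the exponent).
* `eq_zero_of_map_residue_eq_zero_of_unitOrZero` — a polynomial whose coefficients are units or zero and whose reduction vanishes IS zero.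
* `sub_eval_mem_pow_of_lowest` — for `B = Σ_{j<J} F_j(x)` (forms `F_j` of degree `j`) and `F_j = 0` for `j < j₀`: `B ≡ F_{j₀}(x) (mod 𝔪^(j₀+1))`;
  with (G1): `mOrder B = j₀` and `inForm B = F̄_{j₀}` when `F̄_{j₀} ≠ 0` (`mOrder_eq_of_lowest`, `inForm_eq_of_lowest`).

[cite: CossartJannsenSaito2020, §2.2 (p. 24)] [folklore]
bears_on: LADDER-RESOLUTION L ★L-G4 W4.1 (crux `Steer`, binder hK4ⁿᶜ, K-β0(b) `ArithTransportTwoN`, gr bridge (G3)).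
-/

noncomputable section

-- `Summit.<S>.<S>.…` duplicates the summit name by design (single-problem summit).
set_option linter.dupNamespace false

open IsLocalRing MvPolynomial
open Literature.RingTheory.HilbertSamuel Literature.AlgebraicGeometry.Resolution

namespace Summit.ResolutionOfSingularities.ResolutionOfSingularities.Theorems.SwitchingDichotomy.NearPoint

universe u

section Local
variable {A : Type u} [CommRing A] [IsLocalRing A] {e : ℕ} (x : Fin e → A) (hx : Ideal.span (Set.range x) = maximalIdeal A)

/-- A congruence survives multiplication by a constant: `f ≡ F(x) ⇒ u f ≡ (C u · F)(x)` (same degree). -/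
theorem sub_eval_C_mul_mem {v : ℕ} {F : MvPolynomial (Fin e) A} {f : A} (hf : f - eval x F ∈ maximalIdeal A ^ (v + 1)) (u : A) :
    u * f - eval x (C u * F) ∈ maximalIdeal A ^ (v + 1) := by
  rw [map_mul, eval_C, ← mul_sub]
  exact Ideal.mul_mem_left _ u hf

include hx in
/-- A congruence survives multiplication by a power of a parameter, the degree shifting: `f ≡ F(x) (mod 𝔪^(v+1)) ⇒
x_i^b f ≡ (X_i^b F)(x) (mod 𝔪^(v+b+1))`. -/
theorem sub_eval_X_pow_mul_mem {v : ℕ} {F : MvPolynomial (Fin e) A} {f : A} (hf : f - eval x F ∈ maximalIdeal A ^ (v + 1))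
    (i : Fin e) (b : ℕ) : x i ^ b * f - eval x (X i ^ b * F) ∈ maximalIdeal A ^ (v + b + 1) := by
  rw [map_mul, map_pow, eval_X, ← mul_sub, show v + b + 1 = b + (v + 1) by ring, pow_add]
  refine Ideal.mul_mem_mul (Ideal.pow_mem_pow ?_ b) hf
  rw [← hx]; exact Ideal.subset_span ⟨i, rfl⟩

/-- **A polynomial with UNIT-OR-ZERO coefficients whose reduction vanishes is zero.** -/
theorem eq_zero_of_map_residue_eq_zero_of_unitOrZero {σ : Type*} (F : MvPolynomial σ A)
    (hF : ∀ m, IsUnit (coeff m F) ∨ coeff m F = 0) (h0 : MvPolynomial.map (residue A) F = 0) : F = 0 := by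
  ext m
  rw [coeff_zero]
  rcases hF m with hu | hz
  · exfalso
    have hc : residue A (coeff m F) = 0 := by
      have := congrArg (coeff m) h0
      rwa [coeff_map, coeff_zero] at this
    rw [residue_eq_zero_iff] at hc
    exact (mem_maximalIdeal _ |>.mp hc) hu
  · exact hz

include hx in
/-- **Lowest form**: if `B = Σ_{j < J} F_j(x)` with `F_j` a form of degree `j` and `F_j = 0` for all `j < j₀` (`j₀ < J`), then
`B ≡ F_{j₀}(x) (mod 𝔪^(j₀+1))`. -/
theorem sub_eval_mem_pow_of_lowest (J : ℕ) (F : ℕ → MvPolynomial (Fin e) A) (hF : ∀ j, (F j).IsHomogeneous j) (j₀ : ℕ) (hj₀ : j₀ < J)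
    (hlow : ∀ j < j₀, F j = 0) :
    (∑ j ∈ Finset.range J, eval x (F j)) - eval x (F j₀) ∈ maximalIdeal A ^ (j₀ + 1) := by
  classical
  rw [← Finset.sum_erase_add _ _ (Finset.mem_range.mpr hj₀), add_sub_cancel_right]
  refine Ideal.sum_mem _ fun j hj => ?_
  obtain ⟨hne, hjJ⟩ := Finset.mem_erase.mp hj
  by_cases hlt : j < j₀
  · rw [hlow j hlt, map_zero]; exact zero_mem _
  · have hle : j₀ + 1 ≤ j := by omega
    exact Ideal.pow_le_pow_right hle ((initialFormsOf_nonempty_iff x hx _ j).mp ⟨_, F j, hF j, rfl, rfl⟩)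

end Local

section Regular
variable {R : Type u} [CommRing R] [IsRegularLocalRing R] {d : ℕ} (hd : (maximalIdeal R).spanFinrank = d) (x : Fin d → R)
  (hx : Ideal.span (Set.range x) = maximalIdeal R)

include hd hx in
/-- **Order of a sum of forms = the degree of its lowest form with nonzero reduction.** -/
theorem mOrder_eq_of_lowest (J : ℕ) (F : ℕ → MvPolynomial (Fin d) R) (hF : ∀ j, (F j).IsHomogeneous j) (j₀ : ℕ) (hj₀ : j₀ < J)
    (hlow : ∀ j < j₀, F j = 0) (hne : MvPolynomial.map (residue R) (F j₀) ≠ 0) :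
    mOrder (∑ j ∈ Finset.range J, eval x (F j)) = j₀ :=
  mOrder_eq_of_congruence hd x hx j₀ (F j₀) (hF j₀) hne _ (sub_eval_mem_pow_of_lowest x hx J F hF j₀ hj₀ hlow)

include hd hx in
/-- **Initial form of a sum of forms = the reduction of its lowest nonzero form.** -/
theorem inForm_eq_of_lowest (J : ℕ) (F : ℕ → MvPolynomial (Fin d) R) (hF : ∀ j, (F j).IsHomogeneous j) (j₀ : ℕ) (hj₀ : j₀ < J)
    (hlow : ∀ j < j₀, F j = 0) (hne : MvPolynomial.map (residue R) (F j₀) ≠ 0) :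
    inForm x (∑ j ∈ Finset.range J, eval x (F j)) = MvPolynomial.map (residue R) (F j₀) :=
  inForm_eq_of_congruence hd x hx j₀ (F j₀) (hF j₀) hne _ (sub_eval_mem_pow_of_lowest x hx J F hF j₀ hj₀ hlow)

omit [IsRegularLocalRing R] in
/-- **The lowest form exists**: if some `F j` (`j < J`) is nonzero there is a least such index. -/
theorem exists_lowest (J : ℕ) (F : ℕ → MvPolynomial (Fin d) R) (h : ∃ j < J, F j ≠ 0) :
    ∃ j₀ < J, F j₀ ≠ 0 ∧ ∀ j < j₀, F j = 0 := by
  classical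
  obtain ⟨j, hj, hFj⟩ := h
  refine ⟨Nat.find (⟨j, hj, hFj⟩ : ∃ j, j < J ∧ F j ≠ 0), (Nat.find_spec (⟨j, hj, hFj⟩ : ∃ j, j < J ∧ F j ≠ 0)).1,
    (Nat.find_spec (⟨j, hj, hFj⟩ : ∃ j, j < J ∧ F j ≠ 0)).2, fun j' hj' => ?_⟩
  by_contra hne
  exact Nat.find_min (⟨j, hj, hFj⟩ : ∃ j, j < J ∧ F j ≠ 0) hj' ⟨lt_trans hj' (Nat.find_spec (⟨j, hj, hFj⟩ : ∃ j, j < J ∧ F j ≠ 0)).1, hne⟩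

end Regular

end Summit.ResolutionOfSingularities.ResolutionOfSingularities.Theorems.SwitchingDichotomy.NearPoint

end
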